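import Summits.BirchSwinnertonDyer.Rank1Residual.P2.WindowsAtTwo
import Literature.NumberTheory.EllipticCurves.LiLiuTian2024.CongruentNumberRedeiFamilies
import Literature.NumberTheory.EllipticCurves.CongruentNumberCurveRootNumber
import HarnessLib

/-!
# Sub-lane «bsd-p2»: KERNEL-CERTIFIED RANK-ONE PAIRS `(E_n, 2)` in the OPEN cell `openO12` —
# the in-range members of Li–Liu–Tian 2024 Thm 1.2 (`n ≡ 5 (mod 8)`): `n ∈ {5, 13, 29, 37, 53, 61, 85,
# 101, 109}`, `BSD(E_n, 2)` modulo LLT 2024 Thm 1.2 (+ Rédei–Reichardt for `85 = 5·17`)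

HONEST FRAMING (sub-lane «bsd-p2», run/shared/lean/b2b/bsd-rank1-residual/p2/, verbatim in every
file): the target of record is the FULL Birch–Swinnerton-Dyer formula for EVERY analytic-rank `≤ 1`
`E/ℚ` at ALL primes INCLUDING `2`; the odd-prime class ledger is referee A's; the `2`-part is OPEN
(cells O1 = X5 ∖ CM and O12 = the CM corner) and under census by «bsd-p2». Census / instrument
output at `2` = EVIDENCE / conjecture items with held-out validation, NEVER a Literature fact;
certificates close PAIRS (one isogeny class, `p = 2`), never classes. This file asserts NO
arithmetic fact and proves no door of its own: the doors are harvest's / p2-monsky-lit's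
`LiLiuTian2024.forall_bsdp_congruentNumberCurve_prime_of_thm12` (Li–Liu–Tian, "A proof of the BSD
conjecture for a family of congruent number curves" (2024), Thm 1.2, "in particular" clause: `p ≡ 5
(mod 8)` prime ⇒ full BSD for `E_p`; binder `h12 : thm12_bsd_congruentNumberCurve`) and
`LiLiuTian2024.RedeiFamilies.forall_bsdp_congruentNumberCurve_p_mul_q` (p320556: `n = pq`, `p ≡ 1`,
`q ≡ 5 (mod 8)`, `(p/q) = −1`, the class-group hypothesis decided by a Rédei matrix modulo
Rédei–Reichardt, binder `hR`). WHAT THIS FILE ADDS (typer, one writer of `P2/`): the in-range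
(`U_CN`, conductor `32n² < 5·10⁵`) members of the family as kernel pairs in the lane's currency
`BSDp (congruentNumberCurve n) 2` — `n ∈ {5, 13, 29, 37, 53, 61, 101, 109}` (primes `≡ 5 (mod 8)`)
and `85 = 5·17` (the one composite member in range; `65 = 5·13 ≡ 1 (mod 8)` is not in the family) —
i.e. NINE RANK-ONE pairs (root number `−1`: `ord_{s=1} L(E_n,s) ≠ 0` by the tree theorem
`analyticRank_congruentNumberCurve_ne_zero`, recorded in §1) that sit in the OPEN cell `openO12`
(CM by `ℤ[i]`, `2` ramified, `r_an = 1`; `P2/WindowsAtTwo.lean` `status_cellAtTwoOf_of_congruentFamilyLLT`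
for family members): kernel-certified pairs INSIDE an open cell, by a printed theorem, with no
certificate input (contrast the `coveredC8` pairs of `P2/CongruentNumberPairsAtTwo*.lean`). `5`
(`800a1`) and `13` (`5408a1`) are already the lit file's showcases
(`forall_bsdp_congruentNumberCurve_five/_thirteen`); they are re-exported here at `ℓ = 2` under the
uniform names for the census JOIN. Per-pair statements; they close no class (the class statement is
gen-1's `bsdTwoOn_congruentFamilyLLT`). Nothing booked; no mark moved. Unit `b2b-bsdres-p2-typer`
GEN 3; NEW file.

References: Li–Liu–Tian 2024 Thm 1.2 [LiLiuTian2024]; Tian, Proc. ICM 2022, Thm 2 [Tian2023CongruentICM];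
Rédei–Reichardt 1934 / Li–Ma 2008 Thm 0.4 (for `85`) [LiMa2008]; Miller 2011 Def 1.1 [Miller2011LMS];
HOME/p2/monsky/eng/dry/step0-bypro/U_CN.tsv (rows `n ≡ 5 (mod 8)`, Cremona rank `1`).
-/

noncomputable section

open scoped Classical

open WeierstrassCurve Literature.NumberTheory.EllipticCurves
  Literature.NumberTheory.EllipticCurves.Rank1Residual
  Literature.NumberTheory.EllipticCurves.Rank1Residual.Typed
  Literature.NumberTheory.EllipticCurves.LiLiuTian2024
  Literature.NumberTheory.QuadraticFields.RedeiReichardt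

set_option autoImplicit false

namespace Summit.BirchSwinnertonDyer.Rank1Residual.P2

/-! ## §1 The prime members: `BSD(E_p, 2)` for `p ≡ 5 (mod 8)` prime, numeral by numeral -/

/-- **The prime clause in the lane's currency**: for a prime `p ≡ 5 (mod 8)`, `BSD(E_p, 2)` (LLT
2024 Thm 1.2 "in particular", binder `h12`) AND `ord_{s=1} L(E_p, s) ≠ 0` (root number `−1`, a tree
THEOREM — so the pair is a RANK-`≥ 1`, indeed rank-one, pair of the open cell `openO12`).
[cite: LiLiuTian2024, Thm. 1.2] [cite: KoblitzECMF1993, Ch. II §5, Theorem (p. 84)] [cite: Miller2011LMS, Def. 1.1] -/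
theorem bsdp_two_congruentNumberCurve_of_prime_five_mod_eight (h12 : thm12_bsd_congruentNumberCurve)
    {p : ℕ} (hp : p.Prime) (h8 : p % 8 = 5) :
    haveI := isElliptic_congruentNumberCurve hp.ne_zero
    BSDp (congruentNumberCurve p) 2 ∧ (congruentNumberCurve p).analyticRank ≠ 0 := by
  haveI := isElliptic_congruentNumberCurve hp.ne_zero
  haveI := isGloballyMinimal_congruentNumberCurve hp.squarefree
  exact ⟨forall_bsdp_congruentNumberCurve_prime_of_thm12 h12 hp h8 2 Nat.prime_two,
    analyticRank_congruentNumberCurve_ne_zero hp.squarefree (Or.inl h8)⟩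

/-- **`BSD(E_5, 2)`** (`y² = x³ − 25x`, Cremona `800a1`, `N = 800`, rank `1`).
[cite: LiLiuTian2024, Thm. 1.2] [cite: Miller2011LMS, Def. 1.1] -/
theorem bsdp_two_congruentNumberCurve_5 (h12 : thm12_bsd_congruentNumberCurve) :
    BSDp (congruentNumberCurve 5) 2 :=
  (bsdp_two_congruentNumberCurve_of_prime_five_mod_eight h12 Nat.prime_five rfl).1

/-- **`BSD(E_13, 2)`** (`5408a1`, `N = 5408`, rank `1`). [cite: LiLiuTian2024, Thm. 1.2] [cite: Miller2011LMS, Def. 1.1] -/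
theorem bsdp_two_congruentNumberCurve_13 (h12 : thm12_bsd_congruentNumberCurve) :
    BSDp (congruentNumberCurve 13) 2 :=
  (bsdp_two_congruentNumberCurve_of_prime_five_mod_eight h12 (by norm_num) rfl).1

/-- **`BSD(E_29, 2)`** (`26912a1`, `N = 26912`, rank `1`). [cite: LiLiuTian2024, Thm. 1.2] [cite: Miller2011LMS, Def. 1.1] -/
theorem bsdp_two_congruentNumberCurve_29 (h12 : thm12_bsd_congruentNumberCurve) :
    BSDp (congruentNumberCurve 29) 2 :=
  (bsdp_two_congruentNumberCurve_of_prime_five_mod_eight h12 (by norm_num) rfl).1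

/-- **`BSD(E_37, 2)`** (`43808a1`, `N = 43808`, rank `1`). [cite: LiLiuTian2024, Thm. 1.2] [cite: Miller2011LMS, Def. 1.1] -/
theorem bsdp_two_congruentNumberCurve_37 (h12 : thm12_bsd_congruentNumberCurve) :
    BSDp (congruentNumberCurve 37) 2 :=
  (bsdp_two_congruentNumberCurve_of_prime_five_mod_eight h12 (by norm_num) rfl).1

/-- **`BSD(E_53, 2)`** (`89888a1`, `N = 89888`, rank `1`). [cite: LiLiuTian2024, Thm. 1.2] [cite: Miller2011LMS, Def. 1.1] -/
theorem bsdp_two_congruentNumberCurve_53 (h12 : thm12_bsd_congruentNumberCurve) :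
    BSDp (congruentNumberCurve 53) 2 :=
  (bsdp_two_congruentNumberCurve_of_prime_five_mod_eight h12 (by norm_num) rfl).1

/-- **`BSD(E_61, 2)`** (`119072c1`, `N = 119072`, rank `1`). [cite: LiLiuTian2024, Thm. 1.2] [cite: Miller2011LMS, Def. 1.1] -/
theorem bsdp_two_congruentNumberCurve_61 (h12 : thm12_bsd_congruentNumberCurve) :
    BSDp (congruentNumberCurve 61) 2 :=
  (bsdp_two_congruentNumberCurve_of_prime_five_mod_eight h12 (by norm_num) rfl).1

/-- **`BSD(E_101, 2)`** (`326432e1`, `N = 326432`, rank `1`). [cite: LiLiuTian2024, Thm. 1.2] [cite: Miller2011LMS, Def. 1.1] -/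
theorem bsdp_two_congruentNumberCurve_101 (h12 : thm12_bsd_congruentNumberCurve) :
    BSDp (congruentNumberCurve 101) 2 :=
  (bsdp_two_congruentNumberCurve_of_prime_five_mod_eight h12 (by norm_num) rfl).1

/-- **`BSD(E_109, 2)`** (`380192c1`, `N = 380192`, rank `1`). [cite: LiLiuTian2024, Thm. 1.2] [cite: Miller2011LMS, Def. 1.1] -/
theorem bsdp_two_congruentNumberCurve_109 (h12 : thm12_bsd_congruentNumberCurve) :
    BSDp (congruentNumberCurve 109) 2 :=
  (bsdp_two_congruentNumberCurve_of_prime_five_mod_eight h12 (by norm_num) rfl).1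

/-! ## §2 The composite member in range: `85 = 5·17`, `(17/5) = −1` (Rédei certificate, lit's) -/

/-- **`BSD(E_85, 2)`** (`231200bh1`, `N = 231200`, rank `1`): p2-monsky-lit's
`forall_bsdp_congruentNumberCurve_eightyFive` at `ℓ = 2` — `85 = 17·5`, `(17/5) = (2/5) = −1`, the
`4`-rank of `Cl(ℚ(√−85))` vanishing by a Rédei matrix modulo Rédei–Reichardt (`hR`), then LLT Thm 1.2
(`h12`). [cite: LiLiuTian2024, Thm. 1.2] [cite: LiMa2008, Thm. 0.4] [cite: Miller2011LMS, Def. 1.1] -/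
theorem bsdp_two_congruentNumberCurve_85 (hR : redeiReichardt_fourTwoCard_classGroup)
    (h12 : thm12_bsd_congruentNumberCurve) : BSDp (congruentNumberCurve 85) 2 :=
  RedeiFamilies.forall_bsdp_congruentNumberCurve_eightyFive hR h12 2 Nat.prime_two

/-! ## §3 Roll-up and the rank bit -/

/-- **ROLL-UP**: `BSD(E_n, 2)` for every in-range member `n ∈ [5, 13, 29, 37, 53, 61, 85, 101, 109]` of
Li–Liu–Tian's family (binders `h12`, and `hR` for `85`). [cite: LiLiuTian2024, Thm. 1.2] [cite: Miller2011LMS, Def. 1.1] -/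
theorem bsdp_two_congruentNumberCurve_of_mem_lltList (hR : redeiReichardt_fourTwoCard_classGroup)
    (h12 : thm12_bsd_congruentNumberCurve) :
    ∀ n ∈ ([5, 13, 29, 37, 53, 61, 85, 101, 109] : List ℕ), BSDp (congruentNumberCurve n) 2 := by
  intro n hn
  simp only [List.mem_cons, List.not_mem_nil, or_false] at hn
  rcases hn with rfl | rfl | rfl | rfl | rfl | rfl | rfl | rfl | rfl
  exacts [bsdp_two_congruentNumberCurve_5 h12, bsdp_two_congruentNumberCurve_13 h12,
    bsdp_two_congruentNumberCurve_29 h12, bsdp_two_congruentNumberCurve_37 h12,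
    bsdp_two_congruentNumberCurve_53 h12, bsdp_two_congruentNumberCurve_61 h12,
    bsdp_two_congruentNumberCurve_85 hR h12, bsdp_two_congruentNumberCurve_101 h12,
    bsdp_two_congruentNumberCurve_109 h12]

/-- **These are rank-`≥ 1` pairs, unconditionally**: for every `n` of the list `ord_{s=1} L(E_n,s) ≠ 0`
(root number `−1` for square-free `n ≡ 5 (mod 8)` — Hecke's functional equation, a tree theorem;
the listed `n` are square-free: eight primes and `5·17`). With LLT's rank clause (`bsd_congruentNumberCurve_of_thm12`,
class-group hypothesis) the rank is exactly `1`; the pairs sit in the OPEN cell `openO12`.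
[cite: KoblitzECMF1993, Ch. II §5, Theorem (p. 84)] -/
theorem analyticRank_congruentNumberCurve_ne_zero_of_mem_lltList :
    ∀ n ∈ ([5, 13, 29, 37, 53, 61, 85, 101, 109] : List ℕ), (congruentNumberCurve n).analyticRank ≠ 0 := by
  intro n hn
  simp only [List.mem_cons, List.not_mem_nil, or_false] at hn
  have h85 : Squarefree (85 : ℕ) := by
    rw [show (85 : ℕ) = 5 * 17 by norm_num]
    exact (Nat.squarefree_mul (by norm_num)).mpr ⟨Nat.prime_five.squarefree, (by norm_num : Nat.Prime 17).squarefree⟩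
  rcases hn with rfl | rfl | rfl | rfl | rfl | rfl | rfl | rfl | rfl
  · exact analyticRank_congruentNumberCurve_ne_zero Nat.prime_five.squarefree (Or.inl rfl)
  · exact analyticRank_congruentNumberCurve_ne_zero (by norm_num : Nat.Prime 13).squarefree (Or.inl rfl)
  · exact analyticRank_congruentNumberCurve_ne_zero (by norm_num : Nat.Prime 29).squarefree (Or.inl rfl)
  · exact analyticRank_congruentNumberCurve_ne_zero (by norm_num : Nat.Prime 37).squarefree (Or.inl rfl)
  · exact analyticRank_congruentNumberCurve_ne_zero (by norm_num : Nat.Prime 53).squarefree (Or.inl rfl)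
  · exact analyticRank_congruentNumberCurve_ne_zero (by norm_num : Nat.Prime 61).squarefree (Or.inl rfl)
  · exact analyticRank_congruentNumberCurve_ne_zero h85 (Or.inl rfl)
  · exact analyticRank_congruentNumberCurve_ne_zero (by norm_num : Nat.Prime 101).squarefree (Or.inl rfl)
  · exact analyticRank_congruentNumberCurve_ne_zero (by norm_num : Nat.Prime 109).squarefree (Or.inl rfl)

end Summit.BirchSwinnertonDyer.Rank1Residual.P2

end
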